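import Summits.BirchSwinnertonDyer.Rank1Residual.X2.KeyCongruenceInvariants
import Summits.BirchSwinnertonDyer.Rank1Residual.X2.HigherWeightEisensteinTransfer
import Literature.NumberTheory.EllipticCurves.Greenberg1999.NoProperFiniteIndexSubmoduleOrdinary
import Literature.NumberTheory.EllipticCurves.IwasawaAlgebraPseudoNullProofs
import Mathlib.RingTheory.FiniteLength
import Mathlib.RingTheory.Nakayama
import HarnessLib

/-!
# Class X2 at a NON-SPLIT Eisenstein prime `p ‖ N`: the SINGLE-LEVEL Hida-limit transfer — ONE
# congruent member at depth `m > μ_an(E)` with its main conjecture, plus Kato–Wuthrich and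
# Greenberg's Prop. 4.15 (ii), gives Mazur's main conjecture at the pair (cell `bsd-eis`, seat
# `bsd-eis-cgshw` g16; route `EisensteinPrimes`, crux 3 `MazurMCOnCellB` ∩ non-split = the partner
# atom of crux 4 `BSDpOnCellC`; memo `HOME/cgshw-MEMO-20.md` §2)

HONEST FRAMING (cell `bsd-eis`, run/shared/lean/pub/bsd-eis/): THEOREMS ONLY (no definition, no
named fact, nothing asserted); every published theorem enters as one of the tree's existing NAMED
FACTS taken as a hypothesis; the congruent member with its main conjecture is an INPUT (the typed
datum `X2.CongruentMemberData` of p396260, here at ONE level); nothing booked; X2 stays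
CONSTRUCTION-SHAPED; no label or count moves; BSD is proved for no curve by this file.

## The point (memo §2)

The tree's transfer `X2.mazurMainConjectureAt_of_higherWeightCongruences_of_not_split` (p396260;
Skinner 2016 §3.1 / Castella's erratum / Keller–Yin §5 on the cyclotomic side) asks for a congruent
member of the Hida family through `f_E` with ITS main conjecture at EVERY level `m` and closes by
the Krull intersection. The key-congruence step of Castella–Grossi–Skinner §6 (proof of Thm. 6.1.3:
congruent power series have the same `μ` and `λ` once the modulus exceeds `p^μ`) closes the same
transfer at ONE level: with Kato–Wuthrich's divisibility `char_Λ X(E/ℚ_∞) ∣ (f_E)` at the pair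
(Wuthrich 2014 Thm. 16, PUBLISHED, tree fact `thm16_charIdeal_dvd_multiplicative_of_reducible`) and
`Fitt_Λ X = char_Λ X` (no nonzero finite submodule: Greenberg LNM 1716 Prop. 4.15 (ii), PUBLISHED,
tree fact `Greenberg1999.prop415ii_noFiniteSubmodule_of_ordinary_or_multiplicative`), ONE
`CongruentMemberData p X(E/ℚ_∞) f_E m` at a level `m > μ(f_E)` (`f_E` = the integral lift of
`ϖ·L_p^{MTT}(E)`, so `μ(f_E) = μ_an(E)` up to the period constant — a COMPUTABLE threshold) gives
`char_Λ X(E/ℚ_∞) = (f_E)`, i.e. `X2.MazurMainConjectureAt W p`. In words: to prove Mazur's main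
conjecture at a non-split multiplicative Eisenstein prime it suffices to prove it for ONE
sufficiently congruent good-ordinary member of the Hida family (depth `μ_an(E) + 1`; depth `1` —
any member — when `μ_an(E) = 0`).

## Contents

* §1 `isPseudoNull_of_isArtinian`, `finite_of_length_ne_top`, `forall_length_ne_top_eq_bot_of_forall_finite`
  — the bridge from the PUBLISHED «no nonzero FINITE submodule» (Prop. 4.15 (ii), `Finite`-form) to
  the X11b kernel's «no nonzero submodule of FINITE LENGTH» (`Module.length ≠ ⊤`-form): over
  `Λ = ℤ_p⟦T⟧` a finitely generated Artinian module is pseudo-null (Nakayama on the stable image of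
  `s^n`, `s ∈ 𝔪 ∖ 𝔭`), hence finite (`finite_of_isPseudoNull`).
* §2 `mazurMainConjectureAt_of_singleLevelMember_of_not_split` — THE DOOR; and
  `singleLevel_of_higherWeightCongruences` (p396260's all-levels input implies the single-level one).
* §3 consumers by name: `bsdp_of_singleLevelMember_of_analyticRank_eq_zero_of_not_split` (X2b ∩
  non-split, rank 0 = crux 3 ∩ non-split per pair) and
  `bsdp_of_cellC_of_not_split_of_singleLevelMember_of_schneider` (O9 ∩ non-split modulo Schneider).

What this is NOT: not a proof of any main conjecture (the member's `fitt` is the open higher-weight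
Theorem A of Castella–Grossi–Skinner, or any other source); not a statement at split `p`; the depth
threshold is `μ(f_E)`, not `0`.

References: [CastellaGrossiSkinner2025] proof of Thm. 6.1.3 (eq. key-cong); [Skinner2016PacificMC]
§3.1 p. 192; [KellerYin2024] p. 4 and §5 (PRE, shape only); [Wuthrich2014] Thm. 16 (p. 397);
[GreenbergLNM1716] Prop. 4.15 (ii); [NeukirchSchmidtWingberg2008] (5.1.4) Remark 4; [Washington1997]
§13.2.
-/

set_option autoImplicit false

noncomputable section

open scoped Classical MatrixGroups ModularForm

open CongruenceSubgroup WeierstrassCurve Literature.NumberTheory.EllipticCurves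
  Literature.NumberTheory.EllipticCurves.ModularForms
  Literature.NumberTheory.EllipticCurves.Rank1Residual
  Literature.NumberTheory.EllipticCurves.Rank1Residual.Typed
  Literature.NumberTheory.EllipticCurves.Wuthrich2014
  Literature.NumberTheory.EllipticCurves.SteinWuthrich2013
  Literature.NumberTheory.EllipticCurves.Disegni2020
  Literature.RingTheory.FittingIdeal Literature.NumberTheory.EllipticCurves.Module
  Summit.BirchSwinnertonDyer.Rank1Residual.X11b.CongruenceLimit
  Summit.BirchSwinnertonDyer.Rank1Residual.X1.MuLambda
  Summit.BirchSwinnertonDyer.Rank1Residual.X2.KeyCongruence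

namespace Summit.BirchSwinnertonDyer.Rank1Residual.X2

/-! ### §1. Finite length ⟹ finite, over `Λ = ℤ_p⟦T⟧` -/

section Bridge

variable (p : ℕ) [Fact p.Prime]

/-- **A finitely generated Artinian `Λ`-module is pseudo-null.** For a prime `𝔭 ≠ 𝔪` pick
`s ∈ 𝔪 ∖ 𝔭`; the images `s^n N` stabilise (Artinian), so `s^n N = s·(s^n N)` and Nakayama
(`s ∈ 𝔪 = Jac(Λ)`) gives `s^n N = 0`, i.e. `N_𝔭 = 0`.
[cite: NeukirchSchmidtWingberg2008, Ch. V §1, (5.1.4) Remark 4] [cite: Washington1997, §13.2] -/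
theorem isPseudoNull_of_isArtinian (N : Type*) [AddCommGroup N] [Module (IwasawaAlgebra p) N]
    [Module.Finite (IwasawaAlgebra p) N] [IsArtinian (IwasawaAlgebra p) N] :
    Module.IsPseudoNull (IwasawaAlgebra p) N := by
  intro 𝔭 h𝔭
  have hne := IwasawaAlgebra.ne_maximalIdeal_of_height_le_one p 𝔭.asIdeal h𝔭
  have hnot : ¬ IsLocalRing.maximalIdeal (IwasawaAlgebra p) ≤ 𝔭.asIdeal := fun h =>
    hne ((IsLocalRing.maximalIdeal.isMaximal _).eq_of_le 𝔭.isPrime.ne_top h).symm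
  obtain ⟨s, hs𝔪, hs𝔭⟩ := Set.not_subset.1 hnot
  obtain ⟨n, hn⟩ := IsArtinian.range_smul_pow_stabilizes N s
  set Nn : Submodule (IwasawaAlgebra p) N :=
    LinearMap.range (s ^ n • LinearMap.id : N →ₗ[IwasawaAlgebra p] N) with hNn
  -- `Nn ≤ (s) • Nn`
  have hle : Nn ≤ Ideal.span {s} • Nn := by
    intro x hx
    have hx' : x ∈ LinearMap.range (s ^ (n + 1) • LinearMap.id : N →ₗ[IwasawaAlgebra p] N) := by
      rw [← hn (n + 1) (Nat.le_succ n)]; exact hx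
    obtain ⟨y, rfl⟩ := hx'
    have hrew : (s ^ (n + 1) • LinearMap.id : N →ₗ[IwasawaAlgebra p] N) y =
        s • ((s ^ n • LinearMap.id : N →ₗ[IwasawaAlgebra p] N) y) := by
      simp only [LinearMap.smul_apply, LinearMap.id_coe, id_eq, pow_succ, mul_comm (s ^ n) s,
        mul_smul]
    rw [hrew]
    exact Submodule.smul_mem_smul (Ideal.mem_span_singleton_self s) ⟨y, rfl⟩
  have hfg : Nn.FG := IsNoetherian.noetherian Nn
  have hjac : Ideal.span {s} ≤ (⊥ : Ideal (IwasawaAlgebra p)).jacobson := by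
    rw [IsLocalRing.jacobson_eq_maximalIdeal ⊥ bot_ne_top]
    exact (Ideal.span_singleton_le_iff_mem _).2 hs𝔪
  have hbot : Nn = ⊥ :=
    Submodule.eq_bot_of_le_smul_of_le_jacobson_bot (Ideal.span {s}) Nn hfg hle hjac
  rw [LocalizedModule.subsingleton_iff]
  intro m
  refine ⟨s ^ n, fun h => hs𝔭 (𝔭.isPrime.mem_of_pow_mem _ h), ?_⟩
  have hm : (s ^ n • LinearMap.id : N →ₗ[IwasawaAlgebra p] N) m ∈ Nn := ⟨m, rfl⟩
  rw [hbot, Submodule.mem_bot] at hm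
  simpa using hm

/-- **A submodule of finite length of a `Λ`-module is finite** (finite length ⟹ Artinian and
Noetherian ⟹ pseudo-null ⟹ finite, `finite_of_isPseudoNull`).
[cite: NeukirchSchmidtWingberg2008, Ch. V §1, (5.1.4) Remark 4] -/
theorem finite_of_length_ne_top {M : Type*} [AddCommGroup M] [Module (IwasawaAlgebra p) M]
    (N : Submodule (IwasawaAlgebra p) M) (h : Module.length (IwasawaAlgebra p) N ≠ ⊤) :
    Finite N := by
  have hfl : IsFiniteLength (IwasawaAlgebra p) N := Module.length_ne_top_iff.mp h
  obtain ⟨hnoeth, hart⟩ := isFiniteLength_iff_isNoetherian_isArtinian.mp hfl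
  haveI := hnoeth
  haveI := hart
  exact finite_of_isPseudoNull p N (isPseudoNull_of_isArtinian p N)

/-- **Bridge between the two «no finite submodule» currencies**: if every FINITE submodule of `M`
is `0` (the published form, Greenberg Prop. 4.14/4.15), then every submodule of FINITE LENGTH is
`0` (the form consumed by the X11b kernel `fittingIdeal_zero_eq_charIdeal_of_forall_length`).
[cite: GreenbergLNM1716, Prop. 4.15 (ii)] -/
theorem forall_length_ne_top_eq_bot_of_forall_finite {M : Type*} [AddCommGroup M]
    [Module (IwasawaAlgebra p) M]
    (h : ∀ N : Submodule (IwasawaAlgebra p) M, Finite N → N = ⊥) :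
    ∀ N : Submodule (IwasawaAlgebra p) M, Module.length (IwasawaAlgebra p) N ≠ ⊤ → N = ⊥ :=
  fun N hN => h N (finite_of_length_ne_top p N hN)

end Bridge

/-! ### §2. The single-level door -/

section Door

variable (W : WeierstrassCurve ℚ) [W.IsElliptic] [W.IsGloballyMinimal] (p : ℕ) [Fact p.Prime]

/-- **THE SINGLE-LEVEL DOOR (non-split `p`).** For `W/ℚ` globally minimal elliptic and `p ≠ 2` of
NON-SPLIT multiplicative reduction with `E[p]` reducible, assume: Kato–Wuthrich (`hWu`, Wuthrich
2014 Thm. 16: `X` torsion and `f_E ∈ char_Λ X` for the integral lift `f_E` of `ϖ·L_p^{MTT}(E)`);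
Greenberg's Prop. 4.15 (ii) (`h415`: `X(E/ℚ_∞)` has no nonzero finite `Λ`-submodule); and, for the
cyclotomic data, THE non-split Mazur–Tate–Teitelbaum function and every integral lift `f_E`:
`f_E ≠ 0` and ONE `CongruentMemberData p X f_E m` at SOME level `m > μ(f_E)` — a finite `Λ`-module
`N` with `X/p^m ≅ N/p^m`, `Fitt_Λ(N) = (L_N)` (the member's main conjecture, Fitting form) and
`(L_N) + (p)^m = (f_E) + (p)^m`. THEN Mazur's main conjecture holds at the pair in the tree's
normalisation (`X2.MazurMainConjectureAt W p`). Proof: `Fitt_Λ X = char_Λ X = (g_E)` (torsion + no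
finite submodule), the module congruence gives `(g_E) + (p)^m = (L_N) + (p)^m` (Fitting ideals
commute with base change), and `KeyCongruence.span_eq_span_of_singleLevel_congruences` closes with
`g_E ∣ f_E`. CONDITIONAL on the displayed inputs; nothing asserted about the member.
[cite: CastellaGrossiSkinner2025, proof of Thm. 6.1.3 (eq. key-cong)] [cite: Skinner2016PacificMC, §3.1 (p. 192)]
[cite: Wuthrich2014, Thm. 16 (p. 397)] [cite: GreenbergLNM1716, Prop. 4.15 (ii)] -/
theorem mazurMainConjectureAt_of_singleLevelMember_of_not_split
    (hWu : thm16_charIdeal_dvd_multiplicative_of_reducible)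
    (h415 : Greenberg1999.prop415ii_noFiniteSubmodule_of_ordinary_or_multiplicative)
    (hp : p ≠ 2) (hmult : W.HasMultiplicativeReductionAtPrime p)
    (hns : ¬ W.HasSplitMultiplicativeReductionAtPrime p) (hred : ¬ W.HasIrreducibleModPGaloisRep p)
    (hK : ∀ (κ : ZpExtension ℚ p) (γ : Field.absoluteGaloisGroup ℚ),
        κ.IsCyclotomic → κ.IsTopGenerator γ → IsCyclotomicVariable p γ →
      ∀ {N : ℕ} [NeZero N] (f : CuspForm (Gamma0 N) 2), IsNewformOf W f →
      ∀ (D : W.SelmerDualData κ γ) (ϖ : ℚ), (ϖ : ℝ) * W.realPeriodRat = plusPeriod f →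
      ∀ (L : PowerSeries ℚ_[p]), IsMultPAdicLFunctionOf f p (-1) L →
      ∀ (fE : IwasawaAlgebra p),
        iwasawaToPowerSeries p fE = PowerSeries.C ((ϖ : ℚ) : ℚ_[p]) * L →
        fE ≠ 0 ∧ ∃ m : ℕ, mu fE < m ∧ Nonempty (CongruentMemberData p D.X fE m)) :
    MazurMainConjectureAt W p := by
  intro κ γ hκ hγ hγ' N _ f hf D ϖ hϖ
  -- THE non-split Mazur–Tate–Teitelbaum function and Kato–Wuthrich's integral lift `fE ∈ char X`
  obtain ⟨L, hL⟩ := exists_isMultPAdicLFunctionOf_neg_one_of_nonsplit hf hmult hns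
  have hKW := hWu W p hp hmult hred hκ hγ hγ' hf D ϖ hϖ
  have htors : D.IsTorsion := hKW.1
  obtain ⟨fE, hfEmem, hfE⟩ := hKW.2.1 hns L hL
  haveI : Module.Finite (IwasawaAlgebra p) D.X :=
    (WeierstrassCurve.SelmerDualData.module_finite_of_isCyclotomic W κ hκ D) hγ
  -- a generator `gE` of `char X`, and `gE ∣ fE`
  haveI : (Module.charIdeal (IwasawaAlgebra p) D.X).IsPrincipal := charIdeal_isPrincipal_holds p D.X
  obtain ⟨gE, hgE⟩ := Submodule.IsPrincipal.principal (Module.charIdeal (IwasawaAlgebra p) D.X)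
  have hchar : D.charIdeal = Ideal.span {gE} := hgE
  have hdvd : gE ∣ fE := by
    rw [hchar] at hfEmem
    exact Ideal.mem_span_singleton.mp hfEmem
  -- `Fitt₀ X = char X` (no nonzero finite submodule: Prop. 4.15 (ii))
  have hnf : ∀ N' : Submodule (IwasawaAlgebra p) D.X,
      Module.length (IwasawaAlgebra p) N' ≠ ⊤ → N' = ⊥ :=
    forall_length_ne_top_eq_bot_of_forall_finite p
      (h415 W p (by have h2 := (Fact.out : p.Prime).two_le; omega) (Or.inr hmult) κ γ hκ hγ D
        htors)
  have hFitt : Module.fittingIdeal (IwasawaAlgebra p) D.X 0 = Ideal.span {gE} := by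
    rw [fittingIdeal_zero_eq_charIdeal_of_forall_length p D.X htors hnf]
    exact hchar
  -- the single-level datum
  obtain ⟨hfE0, m, hm, ⟨d⟩⟩ := hK κ γ hκ hγ hγ' f hf D ϖ hϖ L hL fE hfE
  have hm1 : 1 ≤ m := by omega
  set I : Ideal (IwasawaAlgebra p) :=
    (Ideal.span {(PowerSeries.C (p : ℤ_[p]) : IwasawaAlgebra p)}) ^ m with hI
  have hS : Ideal.span {gE} ⊔ I = Ideal.span {d.L} ⊔ I := by
    rw [← hFitt, ← d.fitt hm1]
    exact fittingIdeal_sup_eq_of_quotEquiv I (d.congr hm1) 0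
  have hLc : Ideal.span {fE} ⊔ I = Ideal.span {d.L} ⊔ I := (d.lcongr hm1).symm
  have hspan : Ideal.span ({gE} : Set (IwasawaAlgebra p)) = Ideal.span {fE} :=
    span_eq_span_of_singleLevel_congruences hfE0 hdvd hm hS hLc rfl
  refine ⟨htors, fE, hchar.trans hspan, fun hsplit ↦ absurd hsplit hns, fun _ L' hL' ↦ ⟨1, ?_⟩⟩
  rw [← hL.unique hL', Units.val_one, mul_one, hfE]

/-- **The all-levels input implies the single-level input**: `HigherWeightCongruencesAt W p`
(p396260: a congruent member with its main conjecture at EVERY level) gives the single-level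
hypothesis of `mazurMainConjectureAt_of_singleLevelMember_of_not_split` (take the member at level
`μ(f_E) + 1`). So the single-level door asks for LESS from the higher-weight side, at the price of
the two published inputs Kato–Wuthrich and Prop. 4.15 (ii). [cite: KellerYin2024, p. 4 and §5 (shape only)] -/
theorem singleLevel_of_higherWeightCongruences (hK : HigherWeightCongruencesAt W p) :
    ∀ (κ : ZpExtension ℚ p) (γ : Field.absoluteGaloisGroup ℚ),
        κ.IsCyclotomic → κ.IsTopGenerator γ → IsCyclotomicVariable p γ →
      ∀ {N : ℕ} [NeZero N] (f : CuspForm (Gamma0 N) 2), IsNewformOf W f →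
      ∀ (D : W.SelmerDualData κ γ) (ϖ : ℚ), (ϖ : ℝ) * W.realPeriodRat = plusPeriod f →
      ∀ (L : PowerSeries ℚ_[p]), IsMultPAdicLFunctionOf f p (-1) L →
      ∀ (fE : IwasawaAlgebra p),
        iwasawaToPowerSeries p fE = PowerSeries.C ((ϖ : ℚ) : ℚ_[p]) * L →
        fE ≠ 0 ∧ ∃ m : ℕ, mu fE < m ∧ Nonempty (CongruentMemberData p D.X fE m) := by
  intro κ γ hκ hγ hγ' N _ f hf D ϖ hϖ L hL fE hfE
  obtain ⟨hfE0, hd⟩ := hK κ γ hκ hγ hγ' f hf D ϖ hϖ L hL fE hfE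
  exact ⟨hfE0, mu fE + 1, Nat.lt_succ_self _, hd (mu fE + 1)⟩

end Door

/-! ### §3. Consumers by name -/

section Consumers

variable (W : WeierstrassCurve ℚ) [W.IsElliptic] [W.IsGloballyMinimal] (p : ℕ) [Fact p.Prime]

/-- **X2 ∩ {r_an = 0} ∩ {non-split} = crux 3 `MazurMCOnCellB` ∩ non-split, PER PAIR, from ONE
congruent member and PUBLISHED facts**: the single-level door, then the tree's rank-zero glue
`bsdp_of_mazurMainConjectureAt_of_analyticRank_eq_zero` (Stein–Wuthrich Thm. 6.1, Greenberg–Stevens,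
GZK, modularity). CONDITIONAL on the member datum. [cite: SteinWuthrich2013, Thm. 6.1 (p. 20) and §4.2]
[cite: GreenbergLNM1716, Prop. 4.15 (ii)] -/
theorem bsdp_of_singleLevelMember_of_analyticRank_eq_zero_of_not_split
    (hWu : thm16_charIdeal_dvd_multiplicative_of_reducible)
    (h415 : Greenberg1999.prop415ii_noFiniteSubmodule_of_ordinary_or_multiplicative)
    (hJs : thm61_splitMultiplicative) (hJn : thm61_nonsplitMultiplicative)
    (hHs : exists_isSplitMultCanonical) (hHn : exists_isMultCanonical)
    (hGZK : rank_eq_analyticRank_of_analyticRank_le_one) (hmod : hasEntireLFunction_rat)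
    (hpar : nonempty_modularParametrizationData) (hGS : greenberg_stevens (W := W) (p := p))
    (hX : ClassX2 W p) (hns : ¬ W.HasSplitMultiplicativeReductionAtPrime p) (hr : W.analyticRank = 0)
    (hK : ∀ (κ : ZpExtension ℚ p) (γ : Field.absoluteGaloisGroup ℚ),
        κ.IsCyclotomic → κ.IsTopGenerator γ → IsCyclotomicVariable p γ →
      ∀ {N : ℕ} [NeZero N] (f : CuspForm (Gamma0 N) 2), IsNewformOf W f →
      ∀ (D : W.SelmerDualData κ γ) (ϖ : ℚ), (ϖ : ℝ) * W.realPeriodRat = plusPeriod f →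
      ∀ (L : PowerSeries ℚ_[p]), IsMultPAdicLFunctionOf f p (-1) L →
      ∀ (fE : IwasawaAlgebra p),
        iwasawaToPowerSeries p fE = PowerSeries.C ((ϖ : ℚ) : ℚ_[p]) * L →
        fE ≠ 0 ∧ ∃ m : ℕ, mu fE < m ∧ Nonempty (CongruentMemberData p D.X fE m)) :
    BSDp W p :=
  bsdp_of_mazurMainConjectureAt_of_analyticRank_eq_zero hJs hJn hHs hHn hGZK hmod hpar W p hGS hX.1
    hX.2.2 hr (mazurMainConjectureAt_of_singleLevelMember_of_not_split W p hWu h415 hX.1 hX.2.2 hns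
      hX.2.1 hK)

/-- **O9 ∩ {non-split} (X2c, rank ONE, either parity): `BSD(E,p)` from ONE congruent member,
PUBLISHED facts and the pair's SCHNEIDER CERTIFICATE** — the single-level door, then
`bsdp_of_cellC_of_not_split_of_mazurMainConjectureAt_of_schneider` (Disegni 2020 Thm. 4 leading term,
Stein–Wuthrich Thm. 6.1, Gross–Zagier, GZK). CONDITIONAL. [cite: Disegni2020, Thm. 4 (§3.2)]
[cite: GreenbergLNM1716, Prop. 4.15 (ii)] -/
theorem bsdp_of_cellC_of_not_split_of_singleLevelMember_of_schneider
    (hWu : thm16_charIdeal_dvd_multiplicative_of_reducible)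
    (h415 : Greenberg1999.prop415ii_noFiniteSubmodule_of_ordinary_or_multiplicative)
    (hDis : padicBSD_rankOne_nonsplitMult) (hJn : thm61_nonsplitMultiplicative)
    (hHn : exists_isMultCanonical) (hGZ : GrossZagier1986_thm_I_7_3)
    (hGZK : rank_eq_analyticRank_of_analyticRank_le_one) (hpar : nonempty_modularParametrizationData)
    (hc : CellC W p) (hns : ¬ W.HasSplitMultiplicativeReductionAtPrime p)
    (hK : ∀ (κ : ZpExtension ℚ p) (γ : Field.absoluteGaloisGroup ℚ),
        κ.IsCyclotomic → κ.IsTopGenerator γ → IsCyclotomicVariable p γ →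
      ∀ {N : ℕ} [NeZero N] (f : CuspForm (Gamma0 N) 2), IsNewformOf W f →
      ∀ (D : W.SelmerDualData κ γ) (ϖ : ℚ), (ϖ : ℝ) * W.realPeriodRat = plusPeriod f →
      ∀ (L : PowerSeries ℚ_[p]), IsMultPAdicLFunctionOf f p (-1) L →
      ∀ (fE : IwasawaAlgebra p),
        iwasawaToPowerSeries p fE = PowerSeries.C ((ϖ : ℚ) : ℚ_[p]) * L →
        fE ≠ 0 ∧ ∃ m : ℕ, mu fE < m ∧ Nonempty (CongruentMemberData p D.X fE m))
    (hSch : ∀ (q : ℚ_[p]) (Dh : PAdicHeightData W p), q ≠ 0 → ‖q‖ < 1 → tateJ q = (W.j : ℚ_[p]) →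
      IsMultCanonical Dh q → SchneiderConjecture Dh) :
    BSDp W p :=
  bsdp_of_cellC_of_not_split_of_mazurMainConjectureAt_of_schneider W p hDis hJn hHn hGZ hGZK hpar hc hns
    (mazurMainConjectureAt_of_singleLevelMember_of_not_split W p hWu h415 hc.2.1 hc.2.2.2 hns hc.2.2.1
      hK) hSch

end Consumers

end Summit.BirchSwinnertonDyer.Rank1Residual.X2

end
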